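import Summits.FinalStateConjecture.FinalStateConjecture.Theorems.RobustClausewiseGenericityAssembly
import Literature.Geometry.Lorentzian.DataFamilyFromSections
import Literature.Geometry.Lorentzian.InitialDataPatch
import Mathlib.Analysis.Calculus.BumpFunction.InnerProduct
import HarnessLib

/-!
# Crux `CensorshipRobust` (stmt-FinalStateConjecture-10131) · line `walls-and-superposition` · stub `stub_crossInterpolant`

The CROSS INTERPOLANT of the piece `TameAxisSuperposition` (registered stub `stub_crossInterpolant` of the
crux-strategist's line `Cruxes/CensorshipRobust/Lines/walls_and_superposition.lean`; differential topology, no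
constraint equations off the cross). Given an admissible datum `d`, a tame probe `G : ℝᵐ → data` and a tame
curve `γ : ℝ¹ → data` through `d`, the `(m+1)`-parameter family

  `P (c, t) = G c + θ(c, t) · (γ t − d)`   (on sections: `h_{P q} = h_{G c} + θ(q) (h_{γ t} − h_d)`, same for `k`),

with `θ` a smooth bump on `ℝ^{m+1}` equal to `1` on the ball of radius `ε₀` and supported in the ball of radius
`R = 2ε₀`, is a jointly smooth family of initial data sets (`Literature…DataFamilyFromSections`): the only
issue is positive definiteness of `h_{P q}`, which off the compact support `K_γ` of the `γ`-deformation is that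
of `h_{G c}`, and on `K_γ` follows for `‖q‖ < 2ε₀` from the positivity of `h_{G c} + h_{γ t} − h_d` near
`q = 0` (`exists_forall_posDef_of_isCompact`, the choice of `ε₀`) by the convex splitting
`h_{G c} + θ(…) = (1 − θ) h_{G c} + θ (h_{G c} + h_{γ t} − h_d)`. On the hyperplane `t = 0` the family is
`G` (as `γ 0 = d`), on the axis `c = 0` it is `γ` for `|t| < ε₀` (as `G 0 = d`, `θ = 1`), it agrees with `d`
off `K_G ∪ K_γ`, and it is admissible on the hyperplane and outside the ball of radius `R` (where `θ = 0`,
so `P q = G c`). `cross_frame` is the linear algebra of the cross `ℝᵐ × {0} ∪ {0} × ℝ ⊂ ℝ^{m+1}`.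

No `def`s, no named facts; standard axioms.
-/

noncomputable section

namespace Summit.FinalStateConjecture.FinalStateConjecture.Theorems.RobustClausewiseGenericity

open Literature.Geometry.Lorentzian
open Set Function Filter Metric
open scoped Manifold ContDiff Topology

-- D-0017: single-problem summit, `Summit.<S>.<S>.…` by design.
set_option linter.dupNamespace false
-- instance search through nested operator types `E3 →L[ℝ] E3 →L[ℝ] ℝ` (as in `ChartCurvature`)
set_option maxSynthPendingDepth 3

/-- **The linear algebra of the cross in `ℝ^{m+1}`**: the hyperplane embedding `L c = (c, 0)`, the axis
`L₁ s = (0, s)`, the last coordinate `π`, the projection `A (c, t) = c` onto the first `m` coordinates and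
`T (c, t) = t` (as a vector of `ℝ¹`), with their incidence relations and `‖L₁ s‖ ≤ ‖s‖`. [folklore] -/
theorem cross_frame (m : ℕ) :
    ∃ (L : EuclideanSpace ℝ (Fin m) →ₗ[ℝ] EuclideanSpace ℝ (Fin (m + 1)))
      (L₁ : EuclideanSpace ℝ (Fin 1) →ₗ[ℝ] EuclideanSpace ℝ (Fin (m + 1)))
      (π : EuclideanSpace ℝ (Fin (m + 1)) →L[ℝ] ℝ)
      (A : EuclideanSpace ℝ (Fin (m + 1)) →L[ℝ] EuclideanSpace ℝ (Fin m))
      (T : EuclideanSpace ℝ (Fin (m + 1)) →L[ℝ] EuclideanSpace ℝ (Fin 1)),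
      Function.Injective L ∧ (∀ c, π (L c) = 0) ∧ (∀ s, π (L₁ s) = s 0) ∧
      (∀ c, A (L c) = c) ∧ (∀ s, A (L₁ s) = 0) ∧ (∀ c, T (L c) = 0) ∧ (∀ s, T (L₁ s) = s) ∧
      (∀ q, π q = 0 → T q = 0) ∧ (∀ s, ‖L₁ s‖ ≤ ‖s‖) := by
  let π : EuclideanSpace ℝ (Fin (m + 1)) →L[ℝ] ℝ := EuclideanSpace.proj (Fin.last m)
  let e₁ : EuclideanSpace ℝ (Fin (m + 1)) := EuclideanSpace.single (Fin.last m) (1 : ℝ)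
  let L₁ : EuclideanSpace ℝ (Fin 1) →ₗ[ℝ] EuclideanSpace ℝ (Fin (m + 1)) :=
    (EuclideanSpace.proj (0 : Fin 1) : EuclideanSpace ℝ (Fin 1) →L[ℝ] ℝ).toLinearMap.smulRight e₁
  let Aₗ : EuclideanSpace ℝ (Fin (m + 1)) →ₗ[ℝ] EuclideanSpace ℝ (Fin m) :=
    { toFun := fun q ↦ WithLp.toLp 2 fun i : Fin m ↦ q (Fin.castSucc i)
      map_add' := fun q q' ↦ by ext i; simp
      map_smul' := fun a q ↦ by ext i; simp }
  let A : EuclideanSpace ℝ (Fin (m + 1)) →L[ℝ] EuclideanSpace ℝ (Fin m) := LinearMap.toContinuousLinearMap Aₗ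
  let L : EuclideanSpace ℝ (Fin m) →ₗ[ℝ] EuclideanSpace ℝ (Fin (m + 1)) :=
    { toFun := fun c ↦ WithLp.toLp 2 fun j : Fin (m + 1) ↦ if h : (j : ℕ) < m then c ⟨j, h⟩ else 0
      map_add' := fun c c' ↦ by
        ext j
        simp only [PiLp.add_apply]
        split_ifs <;> simp
      map_smul' := fun a c ↦ by
        ext j
        simp only [PiLp.smul_apply, RingHom.id_apply, smul_eq_mul]
        split_ifs <;> simp }
  let T : EuclideanSpace ℝ (Fin (m + 1)) →L[ℝ] EuclideanSpace ℝ (Fin 1) :=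
    π.smulRight (EuclideanSpace.single (0 : Fin 1) (1 : ℝ))
  have hL : ∀ (c : EuclideanSpace ℝ (Fin m)) (j : Fin (m + 1)),
      L c j = if h : (j : ℕ) < m then c ⟨j, h⟩ else 0 := fun c j ↦ rfl
  have hA : ∀ (q : EuclideanSpace ℝ (Fin (m + 1))) (i : Fin m), A q i = q (Fin.castSucc i) :=
    fun q i ↦ rfl
  have hπ : ∀ q : EuclideanSpace ℝ (Fin (m + 1)), π q = q (Fin.last m) := fun q ↦ rfl
  have hL₁ : ∀ s : EuclideanSpace ℝ (Fin 1), L₁ s = s 0 • e₁ := fun s ↦ rfl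
  have hT : ∀ q : EuclideanSpace ℝ (Fin (m + 1)), T q = π q • EuclideanSpace.single (0 : Fin 1) (1 : ℝ) :=
    fun q ↦ rfl
  have hAL : ∀ c, A (L c) = c := by
    intro c
    ext i
    rw [hA, hL, dif_pos (by simp [i.isLt])]
    exact congrArg _ (Fin.ext rfl)
  have hπL : ∀ c, π (L c) = 0 := by
    intro c
    rw [hπ, hL, dif_neg (by simp)]
  have hπL₁ : ∀ s, π (L₁ s) = s 0 := by
    intro s
    rw [hπ, hL₁, PiLp.smul_apply, PiLp.single_apply, if_pos rfl, smul_eq_mul, mul_one]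
  have hAL₁ : ∀ s, A (L₁ s) = 0 := by
    intro s
    ext i
    rw [hA, hL₁, PiLp.smul_apply, PiLp.single_apply,
      if_neg (Fin.castSucc_lt_last i).ne, smul_zero]
    rfl
  have hTL : ∀ c, T (L c) = 0 := by
    intro c
    rw [hT, hπL, zero_smul]
  have hTL₁ : ∀ s, T (L₁ s) = s := by
    intro s
    rw [hT, hπL₁]
    ext i
    rw [Subsingleton.elim i 0, PiLp.smul_apply, PiLp.single_apply, if_pos rfl, smul_eq_mul,
      mul_one]
  have hπT : ∀ q, π q = 0 → T q = 0 := by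
    intro q hq
    rw [hT, hq, zero_smul]
  have hnorm : ∀ s, ‖L₁ s‖ ≤ ‖s‖ := by
    intro s
    rw [hL₁, norm_smul, PiLp.norm_single, norm_one, mul_one]
    exact PiLp.norm_apply_le s 0
  refine ⟨L, L₁, π, A, T, fun c c' h ↦ ?_, hπL, hπL₁, hAL, hAL₁, hTL, hTL₁, hπT, hnorm⟩
  rw [← hAL c, ← hAL c', h]

/-- Pointwise form of the interpolated bilinear forms `A + θ • (B − C)`. [folklore] -/
theorem affine_bilin_apply {F : Type*} [AddCommGroup F] [Module ℝ F] [TopologicalSpace F]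
    (A B C : F →L[ℝ] F →L[ℝ] ℝ) (θ : ℝ) (v w : F) :
    (A + θ • (B - C)) v w = A v w + θ * (B v w - C v w) := by
  simp only [add_apply, FunLike.coe_smul, FunLike.coe_sub, Pi.smul_apply, Pi.sub_apply, smul_eq_mul]

/-- Pointwise form of `A + (B − C)`. [folklore] -/
theorem affine_bilin_apply_aux {F : Type*} [AddCommGroup F] [Module ℝ F] [TopologicalSpace F]
    (A B C : F →L[ℝ] F →L[ℝ] ℝ) (v w : F) :
    (A + (B - C)) v w = A v w + (B v w - C v w) := by
  simp only [add_apply, FunLike.coe_sub, Pi.sub_apply]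

/-- **Convex splitting**: `a + θ (b − c) = (1 − θ) a + θ (a + b − c) > 0` for `a > 0`, `a + (b − c) > 0`,
`0 ≤ θ ≤ 1`. [folklore] -/
theorem pos_affine_of_pos {a b c θ : ℝ} (ha : 0 < a) (hs : 0 < a + (b - c)) (h0 : 0 ≤ θ) (h1 : θ ≤ 1) :
    0 < a + θ * (b - c) := by
  nlinarith [mul_nonneg h0 hs.le, mul_nonneg (sub_nonneg.2 h1) ha.le]

set_option maxHeartbeats 1600000 in
/-- **stub_crossInterpolant** — the CROSS INTERPOLANT of the piece `TameAxisSuperposition` of crux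
`CensorshipRobust` (registered stub of line `walls-and-superposition`): a tame probe `G` and a tame curve `γ`
through the admissible datum `d` are joined by the jointly smooth `(m+1)`-parameter family
`P (c, t) = G c + θ(c, t) (γ t − d)` (`θ` a bump), which is `G` on the hyperplane, `γ` on the axis near `0`,
equal to `d` off a compact set, and admissible on the hyperplane and outside a parameter ball (its members off
the cross need NOT solve the constraints). [folklore] -/
theorem stub_crossInterpolant :
    ∀ (X : Type) [TopologicalSpace X] [ChartedSpace E3 X] [IsManifold (𝓡 3) ∞ X] [T2Space X]
      [SecondCountableTopology X] [ConnectedSpace X], ∀ d ∈ admissibleVacuumData X,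
      ∀ (m : ℕ) (G : EuclideanSpace ℝ (Fin m) → InitialDataSet (𝓡 3) X)
        (γ : EuclideanSpace ℝ (Fin 1) → InitialDataSet (𝓡 3) X), Tame d m G → Tame d 1 γ →
        ∃ (P : EuclideanSpace ℝ (Fin (m + 1)) → InitialDataSet (𝓡 3) X)
          (L : EuclideanSpace ℝ (Fin m) →ₗ[ℝ] EuclideanSpace ℝ (Fin (m + 1)))
          (L₁ : EuclideanSpace ℝ (Fin 1) →ₗ[ℝ] EuclideanSpace ℝ (Fin (m + 1)))
          (π : EuclideanSpace ℝ (Fin (m + 1)) →L[ℝ] ℝ) (ε₀ R : ℝ),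
          Function.Injective L ∧ (∀ c, π (L c) = 0) ∧ (∀ s, π (L₁ s) = s 0) ∧ 0 < ε₀ ∧
          InitialDataSet.IsSmoothDataFamily (m + 1) P ∧
          (∃ K : Set X, IsCompact K ∧ ∀ q, ∀ x ∉ K, (P q).h.inner x = d.h.inner x ∧ (P q).k x = d.k x) ∧
          (∀ c, P (L c) = G c) ∧ (∀ s, ‖s‖ < ε₀ → P (L₁ s) = γ s) ∧
          (∀ q, π q = 0 → P q ∈ admissibleVacuumData X) ∧
          (∀ q, R ≤ ‖q‖ → P q ∈ admissibleVacuumData X) := by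
  intro X _ _ _ _ _ _ d hd m G γ hG hγ
  obtain ⟨L, L₁, π, A, T, hLinj, hπL, hπL₁, hAL, hAL₁, hTL, hTL₁, hπT, hL₁norm⟩ := cross_frame m
  obtain ⟨hGs, hG0, hGadm, KG, hKG, hGK⟩ := hG
  obtain ⟨hγs, hγ0, hγadm, Kγ, hKγ, hγK⟩ := hγ
  /- joint smoothness of the section families `(q, x) ↦ h_{G (A q)}(x)`, `h_{γ (T q)}(x)`, `h_d(x)` (and `k`) -/
  have hFA : ContMDiff (𝓘(ℝ, EuclideanSpace ℝ (Fin (m + 1))).prod (𝓡 3))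
      ((𝓘(ℝ, EuclideanSpace ℝ (Fin m))).prod (𝓡 3)) ∞
      (fun p : EuclideanSpace ℝ (Fin (m + 1)) × X ↦ ((A p.1, p.2) : EuclideanSpace ℝ (Fin m) × X)) :=
    (A.contMDiff.comp contMDiff_fst).prodMk contMDiff_snd
  have hFT : ContMDiff (𝓘(ℝ, EuclideanSpace ℝ (Fin (m + 1))).prod (𝓡 3))
      ((𝓘(ℝ, EuclideanSpace ℝ (Fin 1))).prod (𝓡 3)) ∞
      (fun p : EuclideanSpace ℝ (Fin (m + 1)) × X ↦ ((T p.1, p.2) : EuclideanSpace ℝ (Fin 1) × X)) :=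
    (T.contMDiff.comp contMDiff_fst).prodMk contMDiff_snd
  have hAh : ContMDiff (𝓘(ℝ, EuclideanSpace ℝ (Fin (m + 1))).prod (𝓡 3))
      ((𝓡 3).prod 𝓘(ℝ, E3 →L[ℝ] E3 →L[ℝ] ℝ)) ∞
      (fun p : EuclideanSpace ℝ (Fin (m + 1)) × X ↦ Bundle.TotalSpace.mk' (E3 →L[ℝ] E3 →L[ℝ] ℝ)
        (E := fun x : X ↦ TangentSpace (𝓡 3) x →L[ℝ] TangentSpace (𝓡 3) x →L[ℝ] ℝ) p.2
        ((G (A p.1)).h.inner p.2)) := hGs.1.comp hFA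
  have hAk : ContMDiff (𝓘(ℝ, EuclideanSpace ℝ (Fin (m + 1))).prod (𝓡 3))
      ((𝓡 3).prod 𝓘(ℝ, E3 →L[ℝ] E3 →L[ℝ] ℝ)) ∞
      (fun p : EuclideanSpace ℝ (Fin (m + 1)) × X ↦ Bundle.TotalSpace.mk' (E3 →L[ℝ] E3 →L[ℝ] ℝ)
        (E := fun x : X ↦ TangentSpace (𝓡 3) x →L[ℝ] TangentSpace (𝓡 3) x →L[ℝ] ℝ) p.2
        ((G (A p.1)).k p.2)) := hGs.2.comp hFA
  have hBh : ContMDiff (𝓘(ℝ, EuclideanSpace ℝ (Fin (m + 1))).prod (𝓡 3))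
      ((𝓡 3).prod 𝓘(ℝ, E3 →L[ℝ] E3 →L[ℝ] ℝ)) ∞
      (fun p : EuclideanSpace ℝ (Fin (m + 1)) × X ↦ Bundle.TotalSpace.mk' (E3 →L[ℝ] E3 →L[ℝ] ℝ)
        (E := fun x : X ↦ TangentSpace (𝓡 3) x →L[ℝ] TangentSpace (𝓡 3) x →L[ℝ] ℝ) p.2
        ((γ (T p.1)).h.inner p.2)) := hγs.1.comp hFT
  have hBk : ContMDiff (𝓘(ℝ, EuclideanSpace ℝ (Fin (m + 1))).prod (𝓡 3))
      ((𝓡 3).prod 𝓘(ℝ, E3 →L[ℝ] E3 →L[ℝ] ℝ)) ∞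
      (fun p : EuclideanSpace ℝ (Fin (m + 1)) × X ↦ Bundle.TotalSpace.mk' (E3 →L[ℝ] E3 →L[ℝ] ℝ)
        (E := fun x : X ↦ TangentSpace (𝓡 3) x →L[ℝ] TangentSpace (𝓡 3) x →L[ℝ] ℝ) p.2
        ((γ (T p.1)).k p.2)) := hγs.2.comp hFT
  have hCh := (InitialDataSet.isSmoothDataFamily_const (I := 𝓡 3) (m + 1) d).1
  have hCk := (InitialDataSet.isSmoothDataFamily_const (I := 𝓡 3) (m + 1) d).2
  /- the choice of `ε₀`: `h_{G (A q)} + (h_{γ (T q)} − h_d)` is positive definite on `K_γ` for `‖q‖ < ε` -/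
  have hSh := InitialDataSet.contMDiff_bilinSection_add hAh
    (InitialDataSet.contMDiff_bilinSection_sub hBh hCh)
  obtain ⟨ε, hε, hSpos⟩ := InitialDataSet.exists_forall_posDef_of_isCompact
    (s := fun (q : EuclideanSpace ℝ (Fin (m + 1))) (x : X) ↦
      (G (A q)).h.inner x + ((γ (T q)).h.inner x - d.h.inner x))
    (fun x ↦ (hSh (0, x)).continuousAt) (fun x v hv ↦ by
      have h : (G (A 0)).h.inner x + ((γ (T 0)).h.inner x - d.h.inner x) = d.h.inner x := by
        rw [map_zero, map_zero, hG0, hγ0, sub_self, add_zero]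
      rw [h]
      exact d.h.pos x v hv) hKγ
  -- the bump `θ`: `= 1` on the closed `ε₀`-ball, supported in the `ε`-ball, `ε₀ = ε / 2`
  obtain ⟨ε₀, hε₀pos, hε₀lt⟩ : ∃ ε₀ : ℝ, 0 < ε₀ ∧ ε₀ < ε := ⟨ε / 2, by positivity, by linarith⟩
  obtain ⟨θ, hθin, hθout⟩ : ∃ θ : ContDiffBump (0 : EuclideanSpace ℝ (Fin (m + 1))),
      θ.rIn = ε₀ ∧ θ.rOut = ε := ⟨⟨ε₀, ε, hε₀pos, hε₀lt⟩, rfl, rfl⟩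
  have hθs : ContMDiff (𝓘(ℝ, EuclideanSpace ℝ (Fin (m + 1))).prod (𝓡 3)) 𝓘(ℝ) ∞
      (fun p : EuclideanSpace ℝ (Fin (m + 1)) × X ↦ (θ : EuclideanSpace ℝ (Fin (m + 1)) → ℝ) p.1) :=
    θ.contDiff.contMDiff.comp contMDiff_fst
  have hθball : ∀ q, (θ : EuclideanSpace ℝ (Fin (m + 1)) → ℝ) q ≠ 0 → ‖q‖ < ε := by
    intro q hq
    by_contra h
    exact hq (θ.zero_of_le_dist (by rwa [dist_zero_right, hθout, ← not_lt]))
  -- the interpolated sections are jointly smooth …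
  have hh : ContMDiff (𝓘(ℝ, EuclideanSpace ℝ (Fin (m + 1))).prod (𝓡 3))
      ((𝓡 3).prod 𝓘(ℝ, E3 →L[ℝ] E3 →L[ℝ] ℝ)) ∞
      (fun p : EuclideanSpace ℝ (Fin (m + 1)) × X ↦ Bundle.TotalSpace.mk' (E3 →L[ℝ] E3 →L[ℝ] ℝ)
        (E := fun x : X ↦ TangentSpace (𝓡 3) x →L[ℝ] TangentSpace (𝓡 3) x →L[ℝ] ℝ) p.2
        ((G (A p.1)).h.inner p.2 + (θ : EuclideanSpace ℝ (Fin (m + 1)) → ℝ) p.1 •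
          ((γ (T p.1)).h.inner p.2 - d.h.inner p.2))) :=
    InitialDataSet.contMDiff_bilinSection_add hAh
      (InitialDataSet.contMDiff_bilinSection_smul hθs (InitialDataSet.contMDiff_bilinSection_sub hBh hCh))
  have hk : ContMDiff (𝓘(ℝ, EuclideanSpace ℝ (Fin (m + 1))).prod (𝓡 3))
      ((𝓡 3).prod 𝓘(ℝ, E3 →L[ℝ] E3 →L[ℝ] ℝ)) ∞
      (fun p : EuclideanSpace ℝ (Fin (m + 1)) × X ↦ Bundle.TotalSpace.mk' (E3 →L[ℝ] E3 →L[ℝ] ℝ)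
        (E := fun x : X ↦ TangentSpace (𝓡 3) x →L[ℝ] TangentSpace (𝓡 3) x →L[ℝ] ℝ) p.2
        ((G (A p.1)).k p.2 + (θ : EuclideanSpace ℝ (Fin (m + 1)) → ℝ) p.1 •
          ((γ (T p.1)).k p.2 - d.k p.2))) :=
    InitialDataSet.contMDiff_bilinSection_add hAk
      (InitialDataSet.contMDiff_bilinSection_smul hθs (InitialDataSet.contMDiff_bilinSection_sub hBk hCk))
  -- … symmetric, and `h` is positive definite (convex splitting on `K_γ`, `h_{G c}` off `K_γ`)
  obtain ⟨P, hPh, hPk, hPs⟩ := InitialDataSet.exists_family_of_sections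
    (hq := fun (q : EuclideanSpace ℝ (Fin (m + 1))) (x : X) ↦
      (G (A q)).h.inner x + (θ : EuclideanSpace ℝ (Fin (m + 1)) → ℝ) q •
        ((γ (T q)).h.inner x - d.h.inner x))
    (kq := fun (q : EuclideanSpace ℝ (Fin (m + 1))) (x : X) ↦
      (G (A q)).k x + (θ : EuclideanSpace ℝ (Fin (m + 1)) → ℝ) q • ((γ (T q)).k x - d.k x))
    hh hk
    (fun q x v w ↦ by
      rw [affine_bilin_apply, affine_bilin_apply, (G (A q)).h.symm x v w, (γ (T q)).h.symm x v w,
        d.h.symm x v w])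
    (fun q x v hv ↦ by
      rw [affine_bilin_apply]
      have hGpos : 0 < (G (A q)).h.inner x v v := (G (A q)).h.pos x v hv
      by_cases hx : x ∈ Kγ
      · by_cases hθq : (θ : EuclideanSpace ℝ (Fin (m + 1)) → ℝ) q = 0
        · rw [hθq, zero_mul, add_zero]
          exact hGpos
        · have hS := hSpos q (hθball q hθq) x hx v hv
          rw [affine_bilin_apply_aux] at hS
          exact pos_affine_of_pos hGpos hS θ.nonneg θ.le_one
      · rw [(hγK (T q) x hx).1, sub_self, mul_zero, add_zero]
        exact hGpos)
    (fun q x v w ↦ by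
      rw [affine_bilin_apply, affine_bilin_apply, (G (A q)).k_symm x v w, (γ (T q)).k_symm x v w,
        d.k_symm x v w])
  -- `P q = G (A q)` as soon as the deformation term vanishes
  have hP_of : ∀ q, (∀ x, (θ : EuclideanSpace ℝ (Fin (m + 1)) → ℝ) q •
      ((γ (T q)).h.inner x - d.h.inner x) = 0) →
      (∀ x, (θ : EuclideanSpace ℝ (Fin (m + 1)) → ℝ) q • ((γ (T q)).k x - d.k x) = 0) →
      P q = G (A q) := by
    intro q h1 h2
    refine InitialDataSet.ext_of_sections (fun x ↦ ?_) (fun x ↦ ?_)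
    · rw [hPh]
      show (G (A q)).h.inner x + _ • ((γ (T q)).h.inner x - d.h.inner x) = _
      rw [h1 x, add_zero]
    · rw [hPk]
      show (G (A q)).k x + _ • ((γ (T q)).k x - d.k x) = _
      rw [h2 x, add_zero]
  have hP_T : ∀ q, T q = 0 → P q = G (A q) := fun q hq ↦
    hP_of q (fun x ↦ by rw [hq, hγ0, sub_self, smul_zero]) (fun x ↦ by rw [hq, hγ0, sub_self, smul_zero])
  have hP_θ : ∀ q, (θ : EuclideanSpace ℝ (Fin (m + 1)) → ℝ) q = 0 → P q = G (A q) := fun q hq ↦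
    hP_of q (fun x ↦ by rw [hq, zero_smul]) (fun x ↦ by rw [hq, zero_smul])
  have hK : ∃ K : Set X, IsCompact K ∧ ∀ q, ∀ x ∉ K, (P q).h.inner x = d.h.inner x ∧ (P q).k x = d.k x := by
    refine ⟨KG ∪ Kγ, hKG.union hKγ, fun q x hx ↦ ?_⟩
    -- agreement with `d` off `K_G ∪ K_γ`
    rw [mem_union, not_or] at hx
    refine ⟨?_, ?_⟩
    · rw [hPh]
      show (G (A q)).h.inner x + _ • ((γ (T q)).h.inner x - d.h.inner x) = _
      rw [(hGK (A q) x hx.1).1, (hγK (T q) x hx.2).1, sub_self, smul_zero, add_zero]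
    · rw [hPk]
      show (G (A q)).k x + _ • ((γ (T q)).k x - d.k x) = _
      rw [(hGK (A q) x hx.1).2, (hγK (T q) x hx.2).2, sub_self, smul_zero, add_zero]
  have hGc : ∀ c, P (L c) = G c := fun c ↦ by
    -- the hyperplane
    rw [hP_T (L c) (hTL c), hAL]
  have hγs' : ∀ s, ‖s‖ < ε₀ → P (L₁ s) = γ s := fun s hs ↦ by
    -- the axis near `0`
    have hθ1 : (θ : EuclideanSpace ℝ (Fin (m + 1)) → ℝ) (L₁ s) = 1 :=
      θ.one_of_mem_closedBall (by
        rw [mem_closedBall, dist_zero_right, hθin]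
        exact (hL₁norm s).trans hs.le)
    refine InitialDataSet.ext_of_sections (fun x ↦ ?_) (fun x ↦ ?_)
    · rw [hPh]
      show (G (A (L₁ s))).h.inner x + _ • ((γ (T (L₁ s))).h.inner x - d.h.inner x) = _
      rw [hAL₁, hG0, hTL₁, hθ1, one_smul, add_sub_cancel]
    · rw [hPk]
      show (G (A (L₁ s))).k x + _ • ((γ (T (L₁ s))).k x - d.k x) = _
      rw [hAL₁, hG0, hTL₁, hθ1, one_smul, add_sub_cancel]
  have hπ0 : ∀ q, π q = 0 → P q ∈ admissibleVacuumData X := fun q hq ↦ by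
    -- the hyperplane `π = 0` is admissible
    rw [hP_T q (hπT q hq)]
    exact hGadm (A q)
  have hR : ∀ q, ε ≤ ‖q‖ → P q ∈ admissibleVacuumData X := fun q hq ↦ by
    -- outside the ball of radius `R = ε` the bump vanishes
    rw [hP_θ q (θ.zero_of_le_dist (by rwa [dist_zero_right, hθout]))]
    exact hGadm (A q)
  exact ⟨P, L, L₁, π, ε₀, ε, hLinj, hπL, hπL₁, hε₀pos, hPs, hK, hGc, hγs', hπ0, hR⟩

end Summit.FinalStateConjecture.FinalStateConjecture.Theorems.RobustClausewiseGenericity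

end

-- buildfix 2026-08-20 (ops-buildfix-1 gen 7): enqueue-only re-land — rebuild after B-9 (p218042) healed this module's import closure; no declaration changed.
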